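import Mathlib
import Literature.AlgebraicGeometry.Resolution.FormalInverseFunction
import Summits.ResolutionOfSingularities.ResolutionOfSingularities.Theorems.WeightedInvariantLocalWeightedDropNCResSurfGraphLoopDefs
import Summits.ResolutionOfSingularities.ResolutionOfSingularities.Theorems.WeightedInvariantLocalWeightedDropTOT2BridgePresentedExit
import Summits.ResolutionOfSingularities.ResolutionOfSingularities.Theorems.WeightedInvariantLocalWeightedDropNCTameBinomialEndGame

/-!
# `WeightedInvariant.LocalWeightedDrop`: NC-resolution settings for the TOT₂ line — GRAPH SURFACES, part 27: RE-COORDINATISING THE BASE PLANE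
# (the twist keeps validity and the head; a win from the twisted position is a win from the position)

Crux item stmt-ResolutionOfSingularities-8899 `LocalWeightedDrop` (route `ResolutionOfSingularities/WeightedInvariant`), ENGINE skeleton v34/v35, residual
`stub_wildWideApexFourStartsWon`; res-L1-w43-strat-1's line `directrix-cut` v3f, piece PL₃, sub-skeleton `pl3_split_v1` (7519a9009475ab47), stub
`stub_apexPlaneSurfaceThree` = the SURFACE sub-case `ApexPlaneSurfaceExit`, reduced (…NCResSurfGraphRegime) to the loop `SurfLoop k m`; design memo
`L/res-L1-w43-stub-4/g6/SURFLOOP-DESIGN.md` §2.  [OURS · L1 W4.3 · chain w43 · seat res-L1-w43-stub-4 gen 6; def-free, on part 19 (`baseChange`, `twist`), the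
tree's formal inverse function theorem (`FormalCoordChange.exists_comp_inverse`), `squarefree_subst_of_legal`, `order_subst_of_isUnit_det`,
`apexPlane_subst_legal`; the count game is the programme's own; nothing here is a statement of any manuscript; AI-produced, gate-checked, weaker than expert
review.]

WHY.  When the shadow of a loop state is a normal crossing, one formal coordinate change `Θ` of the base plane `(x_a, x_b)` — the identity on the base
letters that are boundary letters — makes every boundary trace a unit times a monomial (part 28).  The corresponding substitution of the ambient letters
(`baseChange a b Θ`: `x_a ↦ Θ₀(x_a,x_b)`, `x_b ↦ Θ₁(x_a,x_b)`, other letters fixed) is a legal, letter-preserving coordinate change; it is NOT a move of the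
count game, but a win from the twisted position is a win from the position, because the move `(R_Θ ; Φ, w)` from `b₀` has literally the successors of
the move `(Φ, w)` from `b₀ ∘ R_Θ`.

* `hasSubst_baseChange`, `constantCoeff_baseChange`, `baseChange_of_mem_E`, `subst_baseChange_onPlane`, `subst_baseChange_baseChange`,
  `isUnit_det_baseChange` (via the inverse of `Θ`), `subst_shear_twist` (`shear(ψ∘Θ)^* ∘ R_Θ^* = R_Θ^* ∘ shear(ψ)^*`);
* `inOffPlaneIdeal_of_le_weightedOrder` (converse of part 1's `le_weightedOrder_of_inOffPlaneIdeal`), `inOffPlaneIdeal_baseChange`;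
* **`SurfDatum.Valid.twist`** — validity and the head pass to the twisted state (`Θ` legal, `Θ₀ = x₀` if `a ∈ E`, `Θ₁ = x₁` if `b ∈ E`);
* **`DWinsTo.of_twist`** — a win of the count game from the twisted position `(b₀∘R_Θ, δ^Θ)` is a win from `(b₀, δ)` (targets agreeing off the start).
-/

set_option linter.dupNamespace false -- mandated namespace of this single-conjunct summit

noncomputable section

namespace Summit.ResolutionOfSingularities.ResolutionOfSingularities.Theorems

namespace TameFourTupleDrop

namespace GraphSurf

open MvPowerSeries Literature.AlgebraicGeometry.Resolution

variable {k : Type} [Field k] {m : ℕ}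

/-! ## The base change is a legal, letter-preserving coordinate change -/

/-- The base change has zero constant terms. -/
theorem constantCoeff_baseChange {a b : Fin (m + 1)} {Θ : Fin 2 → MvPowerSeries (Fin 2) k} (hΘ0 : ∀ t, constantCoeff (Θ t) = 0)
    (j : Fin (m + 1)) : constantCoeff (baseChange a b Θ j) = 0 := by
  rw [baseChange]
  split_ifs
  · rw [constantCoeff_onPlane, hΘ0]
  · rw [constantCoeff_onPlane, hΘ0]
  · exact constantCoeff_X j

/-- The base change may be substituted. -/
theorem hasSubst_baseChange {a b : Fin (m + 1)} {Θ : Fin 2 → MvPowerSeries (Fin 2) k} (hΘ0 : ∀ t, constantCoeff (Θ t) = 0) :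
    HasSubst (baseChange a b Θ) :=
  hasSubst_of_constantCoeff_zero (constantCoeff_baseChange hΘ0)

/-- The base change FIXES A BOUNDARY LETTER: every letter off the base, and a base letter on which `Θ` is the identity. -/
theorem baseChange_of_mem_E {a b : Fin (m + 1)} (hab : a ≠ b) {Θ : Fin 2 → MvPowerSeries (Fin 2) k} {E : Finset (Fin (m + 1))}
    (hΘa : a ∈ E → Θ 0 = X 0) (hΘb : b ∈ E → Θ 1 = X 1) {l : Fin (m + 1)} (hl : l ∈ E) : baseChange a b Θ l = X l := by
  by_cases h : l = a ∨ l = b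
  · rcases h with rfl | rfl
    · rw [baseChange_left, hΘa hl, onPlane, subst_X (hasSubst_base _ _)]
      rfl
    · rw [baseChange_right hab, hΘb hl, onPlane, subst_X (hasSubst_base _ _)]
      rfl
  · exact baseChange_of_ne h Θ

/-- THE BASE CHANGE ON A SERIES IN THE BASE LETTERS: `R_Θ^*(P(x_a,x_b)) = (Θ^* P)(x_a, x_b)`. -/
theorem subst_baseChange_onPlane {a b : Fin (m + 1)} (hab : a ≠ b) {Θ : Fin 2 → MvPowerSeries (Fin 2) k} (hΘ0 : ∀ t, constantCoeff (Θ t) = 0)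
    (P : MvPowerSeries (Fin 2) k) : subst (baseChange a b Θ) (onPlane a b P) = onPlane a b (subst Θ P) := by
  rw [subst_onPlane _ (hasSubst_baseChange hΘ0), baseChange_left, baseChange_right hab]
  show subst ![onPlane a b (Θ 0), onPlane a b (Θ 1)] P = subst ![X a, X b] (subst Θ P)
  rw [subst_comp_subst_apply (hasSubst_of_constantCoeff_zero hΘ0) (hasSubst_base a b)]
  congr 1
  funext t
  fin_cases t <;> rfl

/-- Composition of base changes. -/
theorem subst_baseChange_baseChange {a b : Fin (m + 1)} (hab : a ≠ b) {Θ Λ : Fin 2 → MvPowerSeries (Fin 2) k}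
    (hΘ0 : ∀ t, constantCoeff (Θ t) = 0) (j : Fin (m + 1)) :
    subst (baseChange a b Θ) (baseChange a b Λ j) = baseChange a b (fun t => subst Θ (Λ t)) j := by
  by_cases h : j = a ∨ j = b
  · rcases h with rfl | rfl
    · rw [baseChange_left, baseChange_left, subst_baseChange_onPlane hab hΘ0]
    · rw [baseChange_right hab, baseChange_right hab, subst_baseChange_onPlane hab hΘ0]
  · rw [baseChange_of_ne h, baseChange_of_ne h, subst_X (hasSubst_baseChange hΘ0), baseChange_of_ne h]

/-- The identity base change is the identity. -/
theorem baseChange_X (a b j : Fin (m + 1)) : baseChange a b (fun t => (X t : MvPowerSeries (Fin 2) k)) j = X j := by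
  rw [baseChange]
  split_ifs with h1 h2
  · rw [h1, onPlane, subst_X (hasSubst_base _ _)]; rfl
  · rw [h2, onPlane, subst_X (hasSubst_base _ _)]; rfl
  · rfl

/-- THE BASE CHANGE BY A LEGAL `Θ` HAS INVERTIBLE LINEAR PART (its inverse is the base change by the inverse of `Θ`). -/
theorem isUnit_det_baseChange {a b : Fin (m + 1)} (hab : a ≠ b) {Θ : Fin 2 → MvPowerSeries (Fin 2) k} (hΘ0 : ∀ t, constantCoeff (Θ t) = 0)
    (hΘdet : IsUnit (FormalCoordChange.linMat Θ).det) :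
    IsUnit (Matrix.det (Matrix.of fun i j : Fin (m + 1) => coeff (Finsupp.single j 1) (baseChange a b Θ i))) := by
  obtain ⟨Λ, hΛ0, -, hΘΛ⟩ := FormalCoordChange.exists_comp_inverse hΘ0 hΘdet
  refine TOT2E1.isUnit_det_linMat_of_comp_eq_X (φ := baseChange a b Λ) (constantCoeff_baseChange hΘ0) fun s => ?_
  rw [subst_baseChange_baseChange hab hΘ0, show (fun t => subst Θ (Λ t)) = fun t => X t from funext hΘΛ, baseChange_X]

/-- The base change is a count move's coordinate change with any admissible weights (in particular letter-free legality). -/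
theorem legal_baseChange {a b : Fin (m + 1)} (hab : a ≠ b) {Θ : Fin 2 → MvPowerSeries (Fin 2) k} (hΘ0 : ∀ t, constantCoeff (Θ t) = 0)
    (hΘdet : IsUnit (FormalCoordChange.linMat Θ).det) :
    (∀ i, constantCoeff (baseChange a b Θ i) = 0) ∧
      IsUnit (Matrix.det (Matrix.of fun i j : Fin (m + 1) => coeff (Finsupp.single j 1) (baseChange a b Θ i))) :=
  ⟨constantCoeff_baseChange hΘ0, isUnit_det_baseChange hab hΘ0 hΘdet⟩

/-- **THE TWISTED SHEAR**: `shear(ψ∘Θ)^*(R_Θ^* g) = R_Θ^*(shear(ψ)^* g)`. -/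
theorem subst_shear_twist {a b : Fin (m + 1)} (hab : a ≠ b) {Θ : Fin 2 → MvPowerSeries (Fin 2) k} (hΘ0 : ∀ t, constantCoeff (Θ t) = 0)
    {ψ : Fin (m + 1) → MvPowerSeries (Fin 2) k} (hψ : ∀ j, ¬ (j = a ∨ j = b) → constantCoeff (ψ j) = 0)
    (g : MvPowerSeries (Fin (m + 1)) k) :
    subst (shear a b fun j => subst Θ (ψ j)) (subst (baseChange a b Θ) g) = subst (baseChange a b Θ) (subst (shear a b ψ) g) := by
  have hψ' : ∀ j, ¬ (j = a ∨ j = b) → constantCoeff (subst Θ (ψ j)) = 0 := fun j hj => by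
    rw [TOT2E1.constantCoeff_subst_of_constantCoeff_zero _ hΘ0, hψ j hj]
  have hR := hasSubst_baseChange (a := a) (b := b) hΘ0
  rw [subst_comp_subst_apply hR (hasSubst_shear hψ'), subst_comp_subst_apply (hasSubst_shear hψ) hR]
  congr 1
  funext j
  by_cases h : j = a ∨ j = b
  · rcases h with rfl | rfl
    · rw [baseChange_left, subst_shear_onPlane hψ', shear_left, subst_X hR, baseChange_left]
    · rw [baseChange_right hab, subst_shear_onPlane hψ', shear_right, subst_X hR, baseChange_right hab]
  · rw [baseChange_of_ne h, subst_X (hasSubst_shear hψ'), shear_of_ne h, shear_of_ne h, ← coe_substAlgHom hR, map_add, coe_substAlgHom,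
      subst_X hR, baseChange_of_ne h, subst_baseChange_onPlane hab hΘ0]

/-! ## The permissibility ideal under base changes -/

/-- CONVERSE of part 1's `le_weightedOrder_of_inOffPlaneIdeal`. -/
theorem inOffPlaneIdeal_of_le_weightedOrder {a b : Fin (m + 1)} {c : ℕ} {G : MvPowerSeries (Fin (m + 1)) k}
    (h : (c : ℕ∞) ≤ G.weightedOrder (fun j : Fin (m + 1) => if j = a ∨ j = b then 0 else 1)) : InOffPlaneIdeal a b c G := by
  intro E hE
  by_contra hlt
  apply hE
  apply coeff_eq_zero_of_lt_weightedOrder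
  refine lt_of_lt_of_le ?_ h
  rw [weight_indicator_eq_offDeg₂]
  exact_mod_cast not_le.mp hlt

/-- **THE BASE CHANGE KEEPS THE BASE PLANE PERMISSIBLE.** -/
theorem inOffPlaneIdeal_baseChange {a b : Fin (m + 1)} {c : ℕ} {G : MvPowerSeries (Fin (m + 1)) k} (hG : InOffPlaneIdeal a b c G)
    {Θ : Fin 2 → MvPowerSeries (Fin 2) k} (hΘ0 : ∀ t, constantCoeff (Θ t) = 0) :
    InOffPlaneIdeal a b c (subst (baseChange a b Θ) G) := by
  refine inOffPlaneIdeal_of_le_weightedOrder (le_weightedOrder_subst_of_inOffPlaneIdeal hG _ _ (hasSubst_baseChange hΘ0) fun j hj => ?_)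
  rw [baseChange_of_ne hj]
  refine le_weightedOrder _ fun E hE => ?_
  rw [coeff_X, if_neg]
  intro hEj
  subst hEj
  simp [Finsupp.weight_apply, Finsupp.sum_single_index, hj] at hE

/-! ## Validity and the head pass to the twisted state -/

namespace SurfDatum

/-- The total equation of the twisted decoration is the base change of the total equation. -/
theorem total_twist {σ : SurfDatum k m} (hab : σ.a ≠ σ.b) {Θ : Fin 2 → MvPowerSeries (Fin 2) k} (hΘ0 : ∀ t, constantCoeff (Θ t) = 0)
    (hΘa : σ.a ∈ σ.δ.E → Θ 0 = X 0) (hΘb : σ.b ∈ σ.δ.E → Θ 1 = X 1) :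
    (σ.twist Θ).δ.total = subst (GraphSurf.baseChange σ.a σ.b Θ) σ.δ.total := by
  have hR := hasSubst_baseChange (a := σ.a) (b := σ.b) hΘ0
  rw [Decoration.total, Decoration.total, twist_δ_f, twist_δ_E, ← coe_substAlgHom hR, map_mul, map_prod, coe_substAlgHom]
  congr 1
  refine Finset.prod_congr rfl fun l hl => ?_
  rw [subst_X hR, baseChange_of_mem_E hab hΘa hΘb hl]

/-- The product `f·∏_O x_l` of the twisted decoration is the base change of the product. -/
theorem totalO_twist {σ : SurfDatum k m} (hab : σ.a ≠ σ.b) {Θ : Fin 2 → MvPowerSeries (Fin 2) k} (hΘ0 : ∀ t, constantCoeff (Θ t) = 0)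
    (hΘa : σ.a ∈ σ.δ.E → Θ 0 = X 0) (hΘb : σ.b ∈ σ.δ.E → Θ 1 = X 1) :
    (σ.twist Θ).δ.f * ∏ l ∈ (σ.twist Θ).δ.O, X l = subst (GraphSurf.baseChange σ.a σ.b Θ) (σ.δ.f * ∏ l ∈ σ.δ.O, X l) := by
  have hR := hasSubst_baseChange (a := σ.a) (b := σ.b) hΘ0
  rw [twist_δ_f, twist_δ_O, ← coe_substAlgHom hR, map_mul, map_prod, coe_substAlgHom]
  congr 1
  refine Finset.prod_congr rfl fun l hl => ?_
  rw [subst_X hR, baseChange_of_mem_E hab hΘa hΘb (σ.δ.O_subset hl)]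

/-- The head of the twisted decoration. -/
theorem head_twist {σ : SurfDatum k m} (hab : σ.a ≠ σ.b) {Θ : Fin 2 → MvPowerSeries (Fin 2) k} (hΘ0 : ∀ t, constantCoeff (Θ t) = 0)
    (hΘdet : IsUnit (FormalCoordChange.linMat Θ).det) :
    (σ.twist Θ).δ.o = σ.δ.o ∧ (σ.twist Θ).δ.c = σ.δ.c ∧ (σ.twist Θ).δ.head = σ.δ.head := by
  have ho : (σ.twist Θ).δ.o = σ.δ.o := by
    rw [Decoration.o, Decoration.o, twist_δ_f, NCTransport.order_subst_of_isUnit_det (constantCoeff_baseChange hΘ0) (isUnit_det_baseChange hab hΘ0 hΘdet)]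
  have hc : (σ.twist Θ).δ.c = σ.δ.c := by rw [Decoration.c, Decoration.c, ho, twist_δ_O]
  exact ⟨ho, hc, by rw [Decoration.head, Decoration.head, ho, hc]⟩

/-- **VALIDITY PASSES TO THE TWISTED STATE** (OURS · L1 W4.3; memo §2): for a legal `Θ` which is the identity on the base letters that are boundary
letters, the twisted state is valid and has the same head. -/
theorem Valid.twist {σ : SurfDatum k m} (hσ : σ.Valid) {Θ : Fin 2 → MvPowerSeries (Fin 2) k} (hΘ0 : ∀ t, constantCoeff (Θ t) = 0)
    (hΘdet : IsUnit (FormalCoordChange.linMat Θ).det) (hΘa : σ.a ∈ σ.δ.E → Θ 0 = X 0) (hΘb : σ.b ∈ σ.δ.E → Θ 1 = X 1) :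
    (σ.twist Θ).Valid ∧ (σ.twist Θ).δ.head = σ.δ.head := by
  obtain ⟨hadm, hab, hψ, hperm, htwo⟩ := hσ
  have hR0 : ∀ i, constantCoeff (GraphSurf.baseChange σ.a σ.b Θ i) = 0 := constantCoeff_baseChange hΘ0
  have hRdet := isUnit_det_baseChange hab hΘ0 hΘdet
  have hR : HasSubst (GraphSurf.baseChange σ.a σ.b Θ) := hasSubst_baseChange hΘ0
  obtain ⟨ho, hc, hhead⟩ := head_twist (σ := σ) hab hΘ0 hΘdet
  obtain ⟨⟨M, N, h1, h2⟩, hsq, hA3⟩ := hadm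
  refine ⟨⟨?_, hab, fun j hj => ?_, ?_, ?_⟩, hhead⟩
  · -- admissibility
    refine ⟨⟨M, N, ?_, ?_⟩, ?_, fun l hl hdvd => ?_⟩
    · rw [total_twist hab hΘ0 hΘa hΘb, twist_b₀, ← coe_substAlgHom hR, ← map_pow]
      exact map_dvd _ h1
    · rw [total_twist hab hΘ0 hΘa hΘb, twist_b₀, ← coe_substAlgHom hR, ← map_pow]
      exact map_dvd _ h2
    · rw [twist_δ_f]
      exact squarefree_subst_of_legal hR0 hRdet hsq
    · -- a boundary letter dividing `f∘R` divides `f`: pull back along the inverse of `R`, which fixes the letter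
      rw [twist_δ_E] at hl
      rw [twist_δ_f] at hdvd
      obtain ⟨Ψ, hΨ0, hΨR, -⟩ := FormalCoordChange.exists_comp_inverse hR0 hRdet
      have hΨ : HasSubst Ψ := hasSubst_of_constantCoeff_zero hΨ0
      have hback : subst Ψ (subst (GraphSurf.baseChange σ.a σ.b Θ) σ.δ.f) = σ.δ.f := by
        rw [subst_comp_subst_apply hR hΨ, show (fun s => subst Ψ (GraphSurf.baseChange σ.a σ.b Θ s)) = X from funext hΨR]
        exact congrFun subst_self _
      have hΨl : subst Ψ (X l : MvPowerSeries (Fin (m + 1)) k) = X l := by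
        conv_lhs => rw [← baseChange_of_mem_E hab hΘa hΘb hl]
        exact hΨR l
      apply hA3 l hl
      have h := map_dvd (substAlgHom hΨ) hdvd
      simp only [coe_substAlgHom] at h
      rwa [hΨl, hback] at h
  · rw [twist_ψ, TOT2E1.constantCoeff_subst_of_constantCoeff_zero _ hΘ0, hψ j hj]
  · -- the twisted graph surface is permissible
    show InOffPlaneIdeal σ.a σ.b (σ.twist Θ).δ.c (subst (shear σ.a σ.b fun j => subst Θ (σ.ψ j)) ((σ.twist Θ).δ.f * ∏ l ∈ (σ.twist Θ).δ.O, X l))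
    rw [hc, totalO_twist hab hΘ0 hΘa hΘb, subst_shear_twist hab hΘ0 hψ]
    exact inOffPlaneIdeal_baseChange hperm hΘ0
  · -- apex dimension ≤ 2 passes to the legal coordinates
    intro u₁ u₂ u₃ hu₁ hu₂ hu₃
    rw [hc, totalO_twist hab hΘ0 hΘa hΘb] at hu₁ hu₂ hu₃
    have hmv := (isBPermissible_point_X σ.δ).1
    have hord : (σ.δ.f * ∏ l ∈ σ.δ.O, X l).order = (σ.δ.c : ℕ∞) := by
      have h := Decoration.order_subst_totalO (⟨⟨M, N, h1, h2⟩, hsq, hA3⟩ : Admissible σ.b₀ σ.δ) hmv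
      rwa [show subst (fun j => (X j : MvPowerSeries (Fin (m + 1)) k)) (σ.δ.f * ∏ l ∈ σ.δ.O, X l) = σ.δ.f * ∏ l ∈ σ.δ.O, X l from
        congrFun subst_self _] at h
    exact apexPlane_subst_legal _ hR0 hRdet _ hord htwo u₁ u₂ u₃ hu₁ hu₂ hu₃

end SurfDatum

/-! ## A win from the twisted position is a win from the position -/

/-- A count move precomposed with a legal coordinate change is a count move. -/
theorem isCountMove_comp {R Φ : Fin (m + 1) → MvPowerSeries (Fin (m + 1)) k} {w : Fin (m + 1) → ℕ}
    (hR0 : ∀ i, constantCoeff (R i) = 0) (hRdet : IsUnit (Matrix.det (Matrix.of fun i j : Fin (m + 1) => coeff (Finsupp.single j 1) (R i))))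
    (hmv : IsCountMove Φ w) : IsCountMove (fun i => subst Φ (R i)) w := by
  obtain ⟨hΦ0, hΦdet, hw, hpos⟩ := hmv
  refine ⟨fun i => constantCoeff_subst_eq_zero (hasSubst_of_constantCoeff_zero hΦ0) hΦ0 (hR0 i), ?_, hw, hpos⟩
  have h := TOT2E1.linMat_comp R hΦ0
  simp only [FormalCoordChange.linMat] at h
  rw [h, Matrix.det_mul]
  exact hRdet.mul hΦdet

/-- **A WIN FROM THE TWISTED POSITION IS A WIN FROM THE POSITION** (OURS · L1 W4.3).  On the decorated states `(b, δ)` read through `Prod.fst`: if the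
state `σ' = (R^* b, δ')` wins towards `Q` for a legal `R`, and `σ'` is not itself a target, then `σ = (b, δ)` wins towards `Q` — play `(R ; Φ, w)` where
`σ'` plays `(Φ, w)`: the successors are literally the same. -/
theorem DWinsTo.of_twist {Q : MvPowerSeries (Fin (m + 1)) k × Decoration k m → Prop} {b : MvPowerSeries (Fin (m + 1)) k} {δ δ' : Decoration k m}
    {R : Fin (m + 1) → MvPowerSeries (Fin (m + 1)) k} (hR0 : ∀ i, constantCoeff (R i) = 0)
    (hRdet : IsUnit (Matrix.det (Matrix.of fun i j : Fin (m + 1) => coeff (Finsupp.single j 1) (R i))))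
    (h : DWinsTo (St := MvPowerSeries (Fin (m + 1)) k × Decoration k m) Prod.fst Q (subst R b, δ')) (hQ : ¬ Q (subst R b, δ')) :
    DWinsTo (St := MvPowerSeries (Fin (m + 1)) k × Decoration k m) Prod.fst Q (b, δ) := by
  classical
  obtain ⟨T, ρ, hT, hσ'⟩ := h
  by_cases hσ : (b, δ) ∈ T
  · exact ⟨T, ρ, hT, hσ⟩
  have hR : HasSubst R := hasSubst_of_constantCoeff_zero hR0
  refine ⟨insert (b, δ) T, fun τ => if τ = (b, δ) then ρ (subst R b, δ') else ρ τ, ?_, Set.mem_insert _ _⟩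
  intro τ hτ hQτ
  have hne : ∀ τ' ∈ T, τ' ≠ (b, δ) := fun τ' hτ' h => hσ (h ▸ hτ')
  rcases Set.mem_insert_iff.mp hτ with rfl | hτT
  · -- the start: twist the move of `σ'`
    obtain ⟨Φ, w, hmv, hcl⟩ := hT _ hσ' hQ
    refine ⟨fun i => subst Φ (R i), w, isCountMove_comp hR0 hRdet hmv, ?_⟩
    intro c hc hc0 A G hfac hG
    rw [show subst (fun i => subst Φ (R i)) b = subst Φ (subst R b) from
      (subst_comp_subst_apply hR (hasSubst_of_constantCoeff_zero hmv.1) b).symm] at hfac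
    obtain ⟨i, hi, τ', hτ'T, hb', hlt⟩ := hcl c hc hc0 A G hfac hG
    refine ⟨i, hi, τ', Set.mem_insert_of_mem _ hτ'T, hb', ?_⟩
    simp only [if_neg (hne τ' hτ'T), ↓reduceIte]
    exact hlt
  · obtain ⟨Φ, w, hmv, hcl⟩ := hT τ hτT hQτ
    refine ⟨Φ, w, hmv, hcl.mono fun b' => ?_⟩
    rintro ⟨τ', hτ'T, hb', hlt⟩
    refine ⟨τ', Set.mem_insert_of_mem _ hτ'T, hb', ?_⟩
    simp only [if_neg (hne τ' hτ'T), if_neg (hne τ hτT)]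
    exact hlt

end GraphSurf

end TameFourTupleDrop

end Summit.ResolutionOfSingularities.ResolutionOfSingularities.Theorems

end
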